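import Literature.Probability.Process.FWQuasipotentialPaths
import Mathlib.Analysis.Calculus.Gradient.Basic
import HarnessLib

/-!
# Freidlin–Wentzell quasipotential: the completed square and the gradient case

Probability/Process file (sorry-free, no named facts), continuing
`Literature/Probability/Process/FWQuasipotential.lean` and `…/FWQuasipotentialPaths.lean`.

For a drift `b` on a real inner-product space `E`, a function `L : E → ℝ` with gradient `∇L`
and a velocity `v`, **completing the square** gives the pointwise identity
`½‖v − b‖² = ½‖v − b − 2∇L‖² + 2⟪v, ∇L⟫ − 2(⟪b, ∇L⟫ + ‖∇L‖²)` (`fw_complete_square`).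
Consequently:

* **Certificate inequality** (`IsFWPath.two_mul_sub_le_fwAction`): if
  `⟪b, ∇L⟫ + ‖∇L‖² ≤ 0` on a region `K` containing an admissible path `φ` on `[0, T]`, then
  `S_{0T}(φ) ≥ 2 (L(φ T) − L(φ 0))` — by Mathlib's one-sided FTC inequality for right
  derivatives (`intervalIntegral.sub_le_integral_of_hasDeriv_right_of_le`), no absolute
  continuity bookkeeping needed; hence `V_b(A, B) ≥ 2 (inf_B L − sup_A L)`-type bounds
  (`le_fwQuasipotential_of_certificate`, `K = E`). This is the sign certificate the consuming
  route wants to decide numerically.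
* **The gradient (orthogonal-decomposition) case** `b = −∇U + ℓ`, `⟪ℓ, ∇U⟫ = 0`
  (Freidlin–Wentzell, Ch. 4 §3, Thm. 3.1: `V(O, x) = 2U(x) − 2U(O)` near a stable equilibrium
  `O` of `b`): the certificate holds with equality, so `V_b(x₀, x) ≥ 2 (U x − U x₀)` for all
  `x₀, x` (`two_mul_sub_le_fwQuasipotential`); and the reversed trajectory of the *adjoint*
  drift `−(∇U + ℓ)` started at `x` realises the bound: if that trajectory converges to `x₀`
  then `V_b(x₀, x) = 2 (U x − U x₀)` (`fwQuasipotential_eq_two_mul_sub`). We prove the theorem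
  in this "flow-line" form, which is exactly the form of Da Prato–Zabczyk 2014, Thm. 12.25(ii)
  (`I(0, a) = |(-A)^{1/2} a|² + 2U(a)` *if* `z^a(t) → 0`), following their proof: completed
  square (12.51), the reversed flow as control, concatenation with a cheap short path near the
  equilibrium. TODO(general form): in Freidlin–Wentzell's setting (bounded domain `D ∋ O`,
  `U(x) ≤ min_{∂D} U`, `∇U ≠ 0` off `O`) every such `x` is joined to `O` by such a trajectory;
  that ODE/Lyapunov step (global existence and convergence of `ẏ = −(∇U + ℓ)(y)`) is not
  formalized here and is the hypothesis `hψ`, `hlim` of our statements.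

## References

* M. I. Freidlin, A. D. Wentzell, *Random Perturbations of Dynamical Systems*, 3rd ed.,
  Grundlehren 260 (2012), Ch. 4 §3, Thm. 3.1. [FreidlinWentzell2012]
* G. Da Prato, J. Zabczyk, *Stochastic Equations in Infinite Dimensions*, 2nd ed. (2014),
  §12.5.3, Thm. 12.25 and its proof ((12.51)–(12.56)). [DapratoZabczyk2014]
* M. I. Freidlin, *Functional Integration and Partial Differential Equations* (1985), §4.1
  (`V` vs. `U` for potential fields). [Freidlin1985]
-/

noncomputable section

open MeasureTheory Set Filter intervalIntegral
open scoped Topology InnerProductSpace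

namespace Literature.Probability.Process

variable {E : Type*} [NormedAddCommGroup E] [InnerProductSpace ℝ E]

/-! ### Completing the square -/

/-- **Completing the square** (Freidlin–Wentzell, proof of Ch. 4 Thm. 3.1; Da Prato–Zabczyk
2014, (12.51)/(12.53)): for vectors `v` (velocity), `c` (drift) and `g` (gradient),
`½‖v − c‖² = ½‖v − c − 2g‖² + 2⟪v, g⟫ − 2(⟪c, g⟫ + ‖g‖²)`. [folklore] -/
theorem fw_complete_square (v c g : E) :
    (1 / 2) * ‖v - c‖ ^ 2 =
      (1 / 2) * ‖v - c - (2 : ℝ) • g‖ ^ 2 + 2 * ⟪v, g⟫_ℝ - 2 * (⟪c, g⟫_ℝ + ‖g‖ ^ 2) := by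
  have h1 : ‖v - c - (2 : ℝ) • g‖ ^ 2 =
      ‖v - c‖ ^ 2 - 2 * ⟪v - c, (2 : ℝ) • g⟫_ℝ + ‖(2 : ℝ) • g‖ ^ 2 :=
    norm_sub_sq_real _ _
  have h2 : ⟪v - c, (2 : ℝ) • g⟫_ℝ = 2 * (⟪v, g⟫_ℝ - ⟪c, g⟫_ℝ) := by
    rw [real_inner_smul_right, inner_sub_left]
  have h3 : ‖(2 : ℝ) • g‖ ^ 2 = 4 * ‖g‖ ^ 2 := by
    rw [norm_smul, Real.norm_eq_abs, abs_two]
    ring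
  rw [h1, h2, h3]
  ring

/-- **Pointwise certificate**: if `⟪c, g⟫ + ‖g‖² ≤ 0` then `2⟪v, g⟫ ≤ ½‖v − c‖²` for every
`v`. [folklore] -/
theorem two_mul_inner_le_of_certificate {v c g : E} (h : ⟪c, g⟫_ℝ + ‖g‖ ^ 2 ≤ 0) :
    2 * ⟪v, g⟫_ℝ ≤ (1 / 2) * ‖v - c‖ ^ 2 := by
  have := fw_complete_square v c g
  nlinarith [sq_nonneg ‖v - c - (2 : ℝ) • g‖, h]

/-- In the orthogonal decomposition `b = −∇U + ℓ`, `⟪ℓ, ∇U⟫ = 0`, the certificate quantity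
vanishes identically: `⟪b, ∇U⟫ + ‖∇U‖² = 0`. [folklore] -/
theorem inner_add_norm_sq_eq_zero_of_orthogonal {b ℓ gradU : E → E}
    (hb : ∀ y, b y = -gradU y + ℓ y) (horth : ∀ y, ⟪ℓ y, gradU y⟫_ℝ = 0) (y : E) :
    ⟪b y, gradU y⟫_ℝ + ‖gradU y‖ ^ 2 = 0 := by
  rw [hb, inner_add_left, inner_neg_left, real_inner_self_eq_norm_sq, horth]
  ring

/-! ### The certificate inequality -/

section Certificate

variable [CompleteSpace E] {b : E → E} {T : ℝ} {φ : ℝ → E} {K : Set E} {L : E → ℝ} {g : E → E}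

/-- **Certificate inequality (path form).** Let `L` have gradient `g = ∇L` on a region `K`
on which `⟪b, ∇L⟫ + ‖∇L‖² ≤ 0`. Then every admissible path `φ` on `[0, T]` staying in `K`
satisfies `2 (L(φ T) − L(φ 0)) ≤ S_{0T}(φ)`: integrate the pointwise bound
`2 d/dt L(φ t) = 2⟪φ̇⁺, ∇L⟫ ≤ ½‖φ̇⁺ − b(φ)‖²` with the one-sided FTC inequality for right
derivatives. This is the lower-bound half of Freidlin–Wentzell, Ch. 4, Thm. 3.1 /
Da Prato–Zabczyk 2014, (12.56), isolated as a certificate. [folklore] -/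
theorem IsFWPath.two_mul_sub_le_fwAction (hφ : IsFWPath b T φ) (hK : MapsTo φ (Icc 0 T) K)
    (hL : ∀ y ∈ K, HasGradientAt L (g y) y) (hcert : ∀ y ∈ K, ⟪b y, g y⟫_ℝ + ‖g y‖ ^ 2 ≤ 0) :
    2 * (L (φ T) - L (φ 0)) ≤ fwAction b T φ := by
  have hT := hφ.pos
  have hcont : ContinuousOn (fun t => 2 * L (φ t)) (Icc 0 T) := by
    have : ContinuousOn (fun t => L (φ t)) (Icc 0 T) := fun t ht =>
      (hL _ (hK ht)).continuousAt.comp_continuousWithinAt (hφ.continuousOn t ht)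
    exact continuousOn_const.mul this
  have hderiv : ∀ t ∈ Ioo 0 T, HasDerivWithinAt (fun t => 2 * L (φ t))
      (2 * ⟪g (φ t), derivWithin φ (Ioi t) t⟫_ℝ) (Ioi t) t := by
    intro t ht
    have hd : HasDerivWithinAt φ (derivWithin φ (Ioi t) t) (Ioi t) t :=
      (hφ.differentiableWithinAt t ⟨ht.1.le, ht.2⟩).hasDerivWithinAt
    have hc :=
      (hasGradientAt_iff_hasFDerivAt.1 (hL _ (hK ⟨ht.1.le, ht.2.le⟩))).comp_hasDerivWithinAt t hd
    rw [InnerProductSpace.toDual_apply_apply] at hc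
    exact hc.const_mul 2
  have hint : IntegrableOn (fun t => (1 / 2) * ‖derivWithin φ (Ioi t) t - b (φ t)‖ ^ 2)
      (Icc 0 T) :=
    ((intervalIntegrable_iff_integrableOn_Icc_of_le hT.le).1 hφ.intervalIntegrable).const_mul
      (1 / 2)
  have hle : ∀ t ∈ Ioo 0 T, 2 * ⟪g (φ t), derivWithin φ (Ioi t) t⟫_ℝ ≤
      (1 / 2) * ‖derivWithin φ (Ioi t) t - b (φ t)‖ ^ 2 := by
    intro t ht
    rw [real_inner_comm]
    exact two_mul_inner_le_of_certificate (hcert _ (hK ⟨ht.1.le, ht.2.le⟩))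
  have h := intervalIntegral.sub_le_integral_of_hasDeriv_right_of_le hT.le hcont hderiv hint hle
  rw [fwAction, ← intervalIntegral.integral_const_mul]
  linarith

variable {A B : Set E}

/-- **Certificate inequality (quasipotential form).** If `L` has gradient `∇L = g` everywhere
and `⟪b, ∇L⟫ + ‖∇L‖² ≤ 0` on all of `E`, then any `c` with `c ≤ 2 (L y − L x)` for all
`x ∈ A`, `y ∈ B` is a lower bound for `V_b(A, B)` (some competitor must exist, else `V` is the
junk `0`). [folklore] -/
theorem le_fwQuasipotential_of_certificate (hL : ∀ y, HasGradientAt L (g y) y)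
    (hcert : ∀ y, ⟪b y, g y⟫_ℝ + ‖g y‖ ^ 2 ≤ 0) (hne : (fwActionSet b A B).Nonempty) {c : ℝ}
    (hc : ∀ x ∈ A, ∀ y ∈ B, c ≤ 2 * (L y - L x)) : c ≤ fwQuasipotential b A B :=
  le_fwQuasipotential hne fun _ φ hφ hA hB =>
    (hc _ hA _ hB).trans
      (hφ.two_mul_sub_le_fwAction (mapsTo_univ φ _) (fun y _ => hL y) fun y _ => hcert y)

end Certificate

/-! ### The gradient case (Freidlin–Wentzell, Ch. 4, Thm. 3.1) -/

section Gradient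

variable {b ℓ gradU : E → E} {U : E → ℝ} {x₀ x : E} {ψ : ℝ → E} {S : ℝ}

/-! #### The reversed adjoint flow as a competitor -/

/-- Time reversal of a trajectory: if `ψ` has (right-at-`0`) derivative `v s` on `[0, ∞)`,
then `t ↦ ψ (S − t)` has derivative `−v (S − t)` at every `t < S`. [folklore] -/
theorem hasDerivAt_reverseFlow {v : ℝ → E} (hψ : ∀ s, 0 ≤ s → HasDerivWithinAt ψ (v s) (Ici 0) s)
    {t : ℝ} (ht : t < S) : HasDerivAt (fun t => ψ (S - t)) (-v (S - t)) t := by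
  have hs : 0 < S - t := sub_pos.2 ht
  exact ((hψ (S - t) hs.le).hasDerivAt (Ici_mem_nhds hs)).comp_const_sub S t

/-- **The reversed adjoint trajectory is a competitor.** Let `ψ` solve `ψ̇ = −(∇U + ℓ)(ψ)` on
`[0, ∞)` (`∇U = gradU` continuous, `b = −∇U + ℓ`). Then for `S > 0` the reversed segment
`φ(t) = ψ(S − t)` is admissible on `[0, S]`, with velocity defect `φ̇ − b(φ) = 2∇U(φ)`
(Freidlin–Wentzell's extremal `φ̇ = ∇U(φ) + ℓ(φ)`; Da Prato–Zabczyk 2014, proof of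
Thm. 12.25, control `u = 2U'(f)`). [folklore] -/
theorem isFWPath_reverseFlow (hgc : Continuous gradU) (hb : ∀ y, b y = -gradU y + ℓ y)
    (hψ : ∀ s, 0 ≤ s → HasDerivWithinAt ψ (-(gradU (ψ s) + ℓ (ψ s))) (Ici 0) s) (hS : 0 < S) :
    IsFWPath b S (fun t => ψ (S - t)) := by
  have hcψ : ContinuousOn ψ (Ici 0) := fun s hs => (hψ s hs).continuousWithinAt
  have hc : ContinuousOn (fun t => ψ (S - t)) (Icc 0 S) :=
    hcψ.comp (continuousOn_const.sub continuousOn_id) fun t ht => sub_nonneg.2 ht.2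
  have hd : ∀ t ∈ Ico 0 S,
      HasDerivAt (fun t => ψ (S - t)) (gradU (ψ (S - t)) + ℓ (ψ (S - t))) t := by
    intro t ht
    have := hasDerivAt_reverseFlow hψ ht.2
    rwa [neg_neg] at this
  refine ⟨hS, hc, fun t ht => (hd t ht).differentiableAt.differentiableWithinAt, ?_⟩
  have hI : IntegrableOn (fun t => ‖(2 : ℝ) • gradU (ψ (S - t))‖ ^ 2) (Icc 0 S) :=
    (((hgc.comp_continuousOn hc).const_smul (2 : ℝ)).norm.pow 2).integrableOn_Icc
  refine intervalIntegrable_congr_Ioo hS.le (fun t ht => ?_)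
    ((intervalIntegrable_iff_integrableOn_Icc_of_le hS.le).2 hI)
  rw [((hd t ⟨ht.1.le, ht.2⟩).hasDerivWithinAt).derivWithin (uniqueDiffWithinAt_Ioi t), hb]
  congr 2
  rw [two_smul]
  abel

variable [CompleteSpace E]

/-- **Lower bound in the gradient case**: if `b = −∇U + ℓ` with `⟪ℓ, ∇U⟫ = 0` (`U`
differentiable everywhere with gradient `gradU`), then `2 (U x − U x₀) ≤ V_b(x₀, x)` for all
`x₀, x` (given a competitor) — the easy half of Freidlin–Wentzell, Ch. 4, Thm. 3.1, valid with
no basin restriction. [cite: FreidlinWentzell2012, Ch. 4 Thm. 3.1] -/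
theorem two_mul_sub_le_fwQuasipotential (hU : ∀ y, HasGradientAt U (gradU y) y)
    (hb : ∀ y, b y = -gradU y + ℓ y) (horth : ∀ y, ⟪ℓ y, gradU y⟫_ℝ = 0)
    (hne : (fwActionSet b {x₀} {x}).Nonempty) :
    2 * (U x - U x₀) ≤ fwQuasipotential b {x₀} {x} :=
  le_fwQuasipotential_of_certificate hU
    (fun y => (inner_add_norm_sq_eq_zero_of_orthogonal hb horth y).le) hne
    fun x' hx' y hy => by rw [mem_singleton_iff.1 hx', mem_singleton_iff.1 hy]

/-- **Action of the reversed adjoint trajectory**: under `b = −∇U + ℓ`, `⟪ℓ, ∇U⟫ = 0`, the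
reversed segment `φ(t) = ψ(S − t)` of a solution of `ψ̇ = −(∇U + ℓ)(ψ)` costs at most
`2 (U(ψ 0) − U(ψ S))`: its integrand is `½‖2∇U(φ)‖² = 2‖∇U(φ)‖² = 2 d/dt U(φ t)` since
`⟪∇U, ℓ⟫ = 0` (Freidlin–Wentzell, proof of Ch. 4 Thm. 3.1; Da Prato–Zabczyk 2014, (12.56)).
[folklore] -/
theorem fwAction_reverseFlow_le (hU : ∀ y, HasGradientAt U (gradU y) y) (hgc : Continuous gradU)
    (hb : ∀ y, b y = -gradU y + ℓ y) (horth : ∀ y, ⟪ℓ y, gradU y⟫_ℝ = 0)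
    (hψ : ∀ s, 0 ≤ s → HasDerivWithinAt ψ (-(gradU (ψ s) + ℓ (ψ s))) (Ici 0) s) (hS : 0 < S) :
    fwAction b S (fun t => ψ (S - t)) ≤ 2 * (U (ψ 0) - U (ψ S)) := by
  have hp := isFWPath_reverseFlow hgc hb hψ hS
  have horth' : ∀ y, ⟪gradU y, ℓ y⟫_ℝ = 0 := fun y => by
    rw [real_inner_comm]
    exact horth y
  have hd : ∀ t ∈ Ico 0 S,
      HasDerivAt (fun t => ψ (S - t)) (gradU (ψ (S - t)) + ℓ (ψ (S - t))) t := by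
    intro t ht
    have := hasDerivAt_reverseFlow hψ ht.2
    rwa [neg_neg] at this
  have hcont : ContinuousOn (fun t => 2 * U (ψ (S - t))) (Icc 0 S) :=
    continuousOn_const.mul fun t ht =>
      (hU _).continuousAt.comp_continuousWithinAt (hp.continuousOn t ht)
  have hderiv : ∀ t ∈ Ioo 0 S, HasDerivWithinAt (fun t => 2 * U (ψ (S - t)))
      (2 * ‖gradU (ψ (S - t))‖ ^ 2) (Ioi t) t := by
    intro t ht
    have hc := (hasGradientAt_iff_hasFDerivAt.1 (hU (ψ (S - t)))).comp_hasDerivAt t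
      (hd t ⟨ht.1.le, ht.2⟩)
    rw [InnerProductSpace.toDual_apply_apply, inner_add_right, real_inner_self_eq_norm_sq, horth',
      add_zero] at hc
    exact (hc.const_mul 2).hasDerivWithinAt
  have hint : IntegrableOn
      (fun t => (1 / 2) * ‖derivWithin (fun t => ψ (S - t)) (Ioi t) t - b (ψ (S - t))‖ ^ 2)
      (Icc 0 S) :=
    ((intervalIntegrable_iff_integrableOn_Icc_of_le hS.le).1 hp.intervalIntegrable).const_mul
      (1 / 2)
  have hle : ∀ t ∈ Ioo 0 S,
      (1 / 2) * ‖derivWithin (fun t => ψ (S - t)) (Ioi t) t - b (ψ (S - t))‖ ^ 2 ≤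
        2 * ‖gradU (ψ (S - t))‖ ^ 2 := by
    intro t ht
    rw [((hd t ⟨ht.1.le, ht.2⟩).hasDerivWithinAt).derivWithin (uniqueDiffWithinAt_Ioi t), hb]
    have : gradU (ψ (S - t)) + ℓ (ψ (S - t)) - (-gradU (ψ (S - t)) + ℓ (ψ (S - t))) =
        (2 : ℝ) • gradU (ψ (S - t)) := by
      rw [two_smul]
      abel
    rw [this, norm_smul, Real.norm_eq_abs, abs_two]
    nlinarith [sq_nonneg ‖gradU (ψ (S - t))‖]
  have h := intervalIntegral.integral_le_sub_of_hasDeriv_right_of_le hS.le hcont hderiv hint hle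
  rw [fwAction, ← intervalIntegral.integral_const_mul]
  simp only [sub_self, sub_zero] at h
  linarith

/-- **Freidlin–Wentzell's theorem on the quasipotential of a gradient-like field (upper
bound along a flow line).** Let `b = −∇U + ℓ` with `⟪ℓ, ∇U⟫ = 0`, `U` differentiable with
continuous gradient `gradU`, `b` continuous, and let `ψ` solve `ψ̇ = −(∇U + ℓ)(ψ)` on `[0, ∞)`
with `ψ 0 = x` and `ψ s → x₀` as `s → ∞`. Then `V_b(x₀, x) ≤ 2 (U x − U x₀)`: reach `ψ S` from
`x₀` cheaply (`exists_fwAction_le_of_near`), then run `ψ` backwards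
(`fwAction_reverseFlow_le`). This is the attainment half of Freidlin–Wentzell, Ch. 4,
Thm. 3.1, in the flow-line form of Da Prato–Zabczyk 2014, Thm. 12.25(ii) (whose hypothesis is
exactly `z^a(t) → 0`). [cite: FreidlinWentzell2012, Ch. 4 Thm. 3.1] -/
theorem fwQuasipotential_le_two_mul_sub (hU : ∀ y, HasGradientAt U (gradU y) y)
    (hgc : Continuous gradU) (hbc : Continuous b) (hb : ∀ y, b y = -gradU y + ℓ y)
    (horth : ∀ y, ⟪ℓ y, gradU y⟫_ℝ = 0)
    (hψ : ∀ s, 0 ≤ s → HasDerivWithinAt ψ (-(gradU (ψ s) + ℓ (ψ s))) (Ici 0) s)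
    (hψ0 : ψ 0 = x) (hlim : Tendsto ψ atTop (𝓝 x₀)) :
    fwQuasipotential b {x₀} {x} ≤ 2 * (U x - U x₀) := by
  refine le_of_forall_pos_le_add fun ε hε => ?_
  obtain ⟨δ, hδ, hloc⟩ := exists_fwAction_le_of_near hbc x₀ (half_pos hε)
  have hev₁ : ∀ᶠ S in atTop, ‖ψ S - x₀‖ < δ := by
    have : ∀ᶠ S in atTop, ψ S ∈ Metric.ball x₀ δ := hlim (Metric.ball_mem_nhds x₀ hδ)
    filter_upwards [this] with S hS using mem_ball_iff_norm.1 hS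
  have hev₂ : ∀ᶠ S in atTop, U x₀ - ε / 4 < U (ψ S) := by
    have hUc : Tendsto (fun S => U (ψ S)) atTop (𝓝 (U x₀)) :=
      (hU x₀).continuousAt.tendsto.comp hlim
    exact hUc.eventually (lt_mem_nhds (by linarith))
  obtain ⟨S, ⟨hS₁, hS₂⟩, hS⟩ := ((hev₁.and hev₂).and (eventually_gt_atTop (0 : ℝ))).exists
  obtain ⟨T₁, φ₁, hp₁, hφ₁0, hφ₁T, ha₁⟩ := hloc (ψ S) hS₁
  have hp₂ := isFWPath_reverseFlow hgc hb hψ hS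
  have ha₂ := fwAction_reverseFlow_le hU hgc hb horth hψ hS
  have hjoin : φ₁ T₁ = (fun t => ψ (S - t)) 0 := by simp [hφ₁T]
  calc fwQuasipotential b {x₀} {x}
      ≤ fwAction b T₁ φ₁ + fwAction b S (fun t => ψ (S - t)) :=
        fwQuasipotential_le_add hp₁ hp₂ hjoin (by simp [hφ₁0]) (by simp [hψ0])
    _ ≤ ε / 2 + 2 * (U (ψ 0) - U (ψ S)) := add_le_add ha₁ ha₂
    _ ≤ 2 * (U x - U x₀) + ε := by
        rw [hψ0]
        linarith

/-- **Freidlin–Wentzell, Ch. 4, Thm. 3.1 (flow-line form): `V_b(x₀, x) = 2 (U x − U x₀)`.**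
For `b = −∇U + ℓ`, `⟪ℓ, ∇U⟫ = 0` (`U` differentiable with continuous gradient, `b`
continuous), the quasipotential from `x₀` to any point `x` whose adjoint trajectory
`ψ̇ = −(∇U + ℓ)(ψ)`, `ψ 0 = x`, converges to `x₀` equals twice the potential difference.
Freidlin–Wentzell state this for all `x` in `D ∪ ∂D` with `U(x) ≤ min_{∂D} U`, `O = x₀` the
stable equilibrium, where such trajectories exist (see the module docstring,
TODO(general form)); the flow-line hypothesis is that of Da Prato–Zabczyk 2014, Thm. 12.25(ii),
whose proof we follow. [cite: FreidlinWentzell2012, Ch. 4 Thm. 3.1] -/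
theorem fwQuasipotential_eq_two_mul_sub (hU : ∀ y, HasGradientAt U (gradU y) y)
    (hgc : Continuous gradU) (hbc : Continuous b) (hb : ∀ y, b y = -gradU y + ℓ y)
    (horth : ∀ y, ⟪ℓ y, gradU y⟫_ℝ = 0)
    (hψ : ∀ s, 0 ≤ s → HasDerivWithinAt ψ (-(gradU (ψ s) + ℓ (ψ s))) (Ici 0) s)
    (hψ0 : ψ 0 = x) (hlim : Tendsto ψ atTop (𝓝 x₀)) :
    fwQuasipotential b {x₀} {x} = 2 * (U x - U x₀) :=
  le_antisymm (fwQuasipotential_le_two_mul_sub hU hgc hbc hb horth hψ hψ0 hlim)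
    (two_mul_sub_le_fwQuasipotential hU hb horth
      (fwActionSet_nonempty hbc (singleton_nonempty _) (singleton_nonempty _)))

/-- **The pure gradient case `b = −∇U`** (`ℓ = 0`; Freidlin 1985, §4.1: "`V` differs from `U`
only by a constant factor", namely `V(O, x) = 2U(x)` for `U(O) = 0`): if the gradient-descent
trajectory `ψ̇ = −∇U(ψ)` from `x` converges to `x₀` then `V_{−∇U}(x₀, x) = 2 (U x − U x₀)`.
[cite: FreidlinWentzell2012, Ch. 4 Thm. 3.1] -/
theorem fwQuasipotential_eq_two_mul_sub_of_gradient (hU : ∀ y, HasGradientAt U (gradU y) y)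
    (hgc : Continuous gradU) (hb : ∀ y, b y = -gradU y)
    (hψ : ∀ s, 0 ≤ s → HasDerivWithinAt ψ (-gradU (ψ s)) (Ici 0) s)
    (hψ0 : ψ 0 = x) (hlim : Tendsto ψ atTop (𝓝 x₀)) :
    fwQuasipotential b {x₀} {x} = 2 * (U x - U x₀) := by
  have hb' : ∀ y, b y = -gradU y + (0 : E → E) y := fun y => by simp [hb]
  have hbc : Continuous b := by
    have : b = fun y => -gradU y := funext hb
    rw [this]
    exact hgc.neg
  refine fwQuasipotential_eq_two_mul_sub hU hgc hbc hb' (fun y => by simp) (fun s hs => ?_)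
    hψ0 hlim
  simpa using hψ s hs

end Gradient

end Literature.Probability.Process
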